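import Literature.Computability.MetaComplexity.EFModAddUAssocKit
import HarnessLib

/-!
# Modular multiplication in extended Frege, uniform width: the double-and-add template

Layer E (uniform variant) of the `EF`-proof construction kit. `ModMulU.mulT L` computes, on
three `L`-bit words `a`, `b`, `n`, the word `a ⊗ b := (a · b) mod n` (for `a, b < n`, words kept
zero-extended as in `EFModAddU.lean`) by MSB-first double-and-add over the bits of `b`:
`P₀ = 0`, and for stage `s < L` (bit `b_{L-1-s}`): `D_s = P_s ⊕ P_s`, `mk_s = b_{L-1-s} ∧ a`
(bitwise), `P_{s+1} = D_s ⊕ mk_s`, where `⊕` is the uniform modular adder `ModAddU.modAddT`.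
The template is a `Netlist.layout` (`EFLayout.lean`) of `3L + 1` pieces: the zero gate, then per
stage a modular adder, a mask row and a modular adder.

This file: the pieces and their closed-form offsets (`ModMulU.offset_pieces`), the template and
its well-formedness (`ModMulU.wf_mulT`), the view of an occurrence (`ModMulU.View`: the words
`P s`, the stage adders `Dv s`, `Av s`, the masks `mk s`), availability (`View.Avail`) and its
derivation from an available occurrence (`ModMulU.avail_ofOcc`).

## Sources

* H. Vollmer, *Introduction to Circuit Complexity* (Springer 1999), §1.2–1.3 (iterated addition,
  multiplication as straight-line programs).
* J. Krajíček, *Bounded Arithmetic, Propositional Logic, and Complexity Theory* (CUP 1995),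
  §9.2 (elementary laws of binary arithmetic have polynomial-size `EF` proofs).
-/

namespace Literature.Computability.MetaComplexity

open _root_.Computability Complexity Complexity.PropForm Netlist

namespace ModMulU

variable (L : ℕ)

/-! ### The pieces -/

/-- The row of `L` mask gates `mᵢ = sel ∧ xᵢ` on the inputs `[sel, x₀ … x_{L-1}]`.
[cite: Vollmer1999, §1.1] -/
def maskRow (L : ℕ) : Template := (List.range L).map fun i => ⟨Kind.and, [Sum.inl 0, Sum.inl (1 + i)]⟩

/-- Length of the mask row. [folklore] -/
@[simp] theorem length_maskRow : (maskRow L).length = L := by simp [maskRow]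

/-- Gates of the mask row. [folklore] -/
theorem getElem_maskRow {i : ℕ} (h : i < (maskRow L).length) :
    (maskRow L)[i] = ⟨Kind.and, [Sum.inl 0, Sum.inl (1 + i)]⟩ := by simp [maskRow]

/-- The mask row is well formed (`L + 1` inputs). [cite: Vollmer1999, Def. 1.6] -/
theorem wf_maskRow : (maskRow L).WF (L + 1) := by
  intro k hk
  rw [getElem_maskRow]
  refine ⟨rfl, fun a ha => ?_⟩
  simp only [List.mem_cons, List.not_mem_nil, or_false] at ha
  have hk' : k < L := by simpa using hk
  rcases ha with rfl | rfl
  · exact ⟨fun i hi => (by cases hi; omega), fun j hj => by cases hj⟩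
  · exact ⟨fun i hi => (by cases hi; omega), fun j hj => by cases hj⟩

/-- Offset of the doubling adder `D_s` of stage `s`. [folklore] -/
def offD (L s : ℕ) : ℕ := 1 + s * (13 * L + 4)
/-- Offset of the mask row of stage `s`. [folklore] -/
def offM (L s : ℕ) : ℕ := offD L s + (6 * L + 2)
/-- Offset of the accumulating adder `A_s` of stage `s`. [folklore] -/
def offA (L s : ℕ) : ℕ := offD L s + (7 * L + 2)

/-- Reference to bit `i` of the partial product `P_s` (the zero gate for `s = 0`, the output of
`A_{s-1}` otherwise). [folklore] -/
def pRef (L s i : ℕ) : ℕ ⊕ ℕ := if s = 0 then Sum.inr 0 else Sum.inr (offA L (s - 1) + (5 * L + 2) + i)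

/-- Wiring of `D_s = P_s ⊕ P_s` (inputs of the kit: `a` = `0…L-1`, `b` = `L…2L-1`, `n` = `2L…3L-1`).
[folklore] -/
def wD (L s : ℕ) (i : ℕ) : ℕ ⊕ ℕ := if i < L then pRef L s i else if i < 2 * L then pRef L s (i - L) else Sum.inl i

/-- Wiring of the mask row of stage `s`: selector `b_{L-1-s}`, word `a`. [folklore] -/
def wM (L s : ℕ) (t : ℕ) : ℕ ⊕ ℕ := if t = 0 then Sum.inl (L + (L - 1 - s)) else Sum.inl (t - 1)

/-- Wiring of `A_s = D_s ⊕ mk_s`. [folklore] -/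
def wA (L s : ℕ) (i : ℕ) : ℕ ⊕ ℕ :=
  if i < L then Sum.inr (offD L s + (5 * L + 2) + i) else if i < 2 * L then Sum.inr (offM L s + (i - L)) else Sum.inl i

/-- The three pieces of stage `s` by residue: `D_s`, the mask row, `A_s`. [cite: Vollmer1999, §1.2] -/
def pieceSR (L s : ℕ) : ℕ → Piece
  | 0 => ⟨ModAddU.modAddT L, 3 * L, wD L s⟩
  | 1 => ⟨maskRow L, L + 1, wM L s⟩
  | _ => ⟨ModAddU.modAddT L, 3 * L, wA L s⟩

/-- The pieces: the zero gate, then per stage `s` the pieces `1 + 3s` (`D_s`), `2 + 3s` (mask),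
`3 + 3s` (`A_s`). [cite: Vollmer1999, §1.2] -/
def pieces (L : ℕ) (k : ℕ) : Piece :=
  if k = 0 then ⟨[⟨Kind.cst false, []⟩], 0, Sum.inl⟩ else pieceSR L ((k - 1) / 3) ((k - 1) % 3)

/-- The closed-form offsets by residue. [folklore] -/
def offSR (L s : ℕ) : ℕ → ℕ
  | 0 => offD L s
  | 1 => offM L s
  | _ => offA L s

/-- The closed-form offsets. [folklore] -/
def offF (L k : ℕ) : ℕ := if k = 0 then 0 else offSR L ((k - 1) / 3) ((k - 1) % 3)

/-- **The modular multiplier**: the layout of the `3L + 1` pieces. [cite: Vollmer1999, §1.2–1.3] -/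
def mulT (L : ℕ) : Template := layout (pieces L) (3 * L + 1)

/-- Decomposition of a positive piece index. [folklore] -/
theorem exists_sr {k : ℕ} (hk : 0 < k) : ∃ s r, r < 3 ∧ k = 3 * s + r + 1 :=
  ⟨(k - 1) / 3, (k - 1) % 3, Nat.mod_lt _ (by norm_num), by omega⟩

/-- The piece of a decomposed index. [folklore] -/
theorem pieces_sr (s r : ℕ) (hr : r < 3) : pieces L (3 * s + r + 1) = pieceSR L s r := by
  unfold pieces
  rw [if_neg (by omega), show (3 * s + r + 1 - 1) / 3 = s by omega, show (3 * s + r + 1 - 1) % 3 = r by omega]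

/-- The offset formula of a decomposed index. [folklore] -/
theorem offF_sr (s r : ℕ) (hr : r < 3) : offF L (3 * s + r + 1) = offSR L s r := by
  unfold offF
  rw [if_neg (by omega), show (3 * s + r + 1 - 1) / 3 = s by omega, show (3 * s + r + 1 - 1) % 3 = r by omega]

/-- **The offsets of the pieces are the closed forms.** [folklore] -/
theorem offset_pieces : ∀ k, offset (pieces L) k = offF L k := by
  intro k
  induction k with
  | zero => rfl
  | succ k ih =>
    rw [offset_succ, ih]
    rcases Nat.eq_zero_or_pos k with rfl | hk
    · simp [pieces, offF, offSR, offD]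
    · obtain ⟨s, r, hr, rfl⟩ := exists_sr hk
      rw [pieces_sr L s r hr, offF_sr L s r hr]
      interval_cases r
      · rw [show 3 * s + 0 + 1 + 1 = 3 * s + 1 + 1 by ring, offF_sr L s 1 (by norm_num)]
        simp [pieceSR, offSR, offM]
      · rw [show 3 * s + 1 + 1 + 1 = 3 * s + 2 + 1 by ring, offF_sr L s 2 (by norm_num)]
        simp [pieceSR, offSR, offM, offA]; omega
      · rw [show 3 * s + 2 + 1 + 1 = 3 * (s + 1) + 0 + 1 by ring, offF_sr L (s + 1) 0 (by norm_num)]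
        simp [pieceSR, offSR, offA, offD]; ring

/-- Length of the multiplier: `1 + L(13L + 4)` gates. [folklore] -/
@[simp] theorem length_mulT : (mulT L).length = 1 + L * (13 * L + 4) := by
  rw [mulT, length_layout, offset_pieces, show 3 * L + 1 = 3 * L + 0 + 1 by ring, offF_sr L L 0 (by norm_num)]
  simp [offSR, offD]

/-- Every piece is well formed and well wired (`3L` inputs). [cite: Vollmer1999, Def. 1.6] -/
theorem piece_ok : ∀ k < 3 * L + 1, Piece.OK (pieces L) (3 * L) k := by
  intro k hk
  unfold Piece.OK
  rw [offset_pieces]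
  rcases Nat.eq_zero_or_pos k with rfl | hk0
  · simp only [pieces, if_true]
    refine ⟨?_, fun i hi => absurd hi (Nat.not_lt_zero i)⟩
    intro j hj
    simp only [List.length_singleton, Nat.lt_one_iff] at hj
    subst hj
    exact ⟨rfl, fun a ha => absurd ha List.not_mem_nil⟩
  obtain ⟨s, r, hr, rfl⟩ := exists_sr hk0
  have hs : s < L := by omega
  rw [pieces_sr L s r hr, offF_sr L s r hr]
  interval_cases r <;> simp only [pieceSR, offSR]
  · refine ⟨ModAddU.wf_modAddT L, fun i hi => ?_⟩
    unfold wD pRef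
    split_ifs with h1 h2 h3 h4
    · exact ⟨fun a ha => (by cases ha), fun g hg => by cases hg; simp [offD]⟩
    · refine ⟨fun a ha => (by cases ha), fun g hg => ?_⟩
      cases hg
      obtain ⟨t, rfl⟩ : ∃ t, s = t + 1 := ⟨s - 1, by omega⟩
      rw [Nat.add_sub_cancel, offA, offD, offD]
      have e : (t + 1) * (13 * L + 4) = t * (13 * L + 4) + (13 * L + 4) := by ring
      omega
    · exact ⟨fun a ha => (by cases ha), fun g hg => by cases hg; simp [offD]⟩
    · refine ⟨fun a ha => (by cases ha), fun g hg => ?_⟩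
      cases hg
      obtain ⟨t, rfl⟩ : ∃ t, s = t + 1 := ⟨s - 1, by omega⟩
      rw [Nat.add_sub_cancel, offA, offD, offD]
      have e : (t + 1) * (13 * L + 4) = t * (13 * L + 4) + (13 * L + 4) := by ring
      omega
    · exact ⟨fun a ha => (by cases ha; omega), fun g hg => by cases hg⟩
  · refine ⟨wf_maskRow L, fun i hi => ?_⟩
    unfold wM
    split_ifs
    · exact ⟨fun a ha => (by cases ha; omega), fun g hg => by cases hg⟩
    · exact ⟨fun a ha => (by cases ha; omega), fun g hg => by cases hg⟩
  · refine ⟨ModAddU.wf_modAddT L, fun i hi => ?_⟩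
    unfold wA
    split_ifs
    · exact ⟨fun a ha => (by cases ha), fun g hg => by cases hg; simp only [offA, offD]; omega⟩
    · exact ⟨fun a ha => (by cases ha), fun g hg => by cases hg; simp only [offA, offM, offD]; omega⟩
    · exact ⟨fun a ha => (by cases ha; omega), fun g hg => by cases hg⟩

/-- **The modular multiplier is well formed** (`3L` inputs). [cite: Vollmer1999, Def. 1.6] -/
theorem wf_mulT : (mulT L).WF (3 * L) := wf_layout (pieces L) (piece_ok L)

/-! ### The view -/

/-- A view of a modular multiplier: the base of its gates and its operand words. [folklore] -/
structure View where
  /-- the first gate variable (the zero gate) -/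
  base : ℕ
  /-- the multiplicand -/
  a : ℕ → ℕ
  /-- the multiplier (bits used MSB first) -/
  b : ℕ → ℕ
  /-- the modulus -/
  n : ℕ → ℕ

namespace View

variable (V : View) (L : ℕ)

/-- The zero gate. [folklore] -/
def z : ℕ := V.base
/-- The partial product `P_s` (the zero word for `s = 0`). [folklore] -/
def P (s : ℕ) (i : ℕ) : ℕ := if s = 0 then V.base else V.base + offA L (s - 1) + (5 * L + 2) + i
/-- The doubling adder `D_s = P_s ⊕ P_s`. [folklore] -/
def Dv (s : ℕ) : ModAddU.View := ⟨V.base + offD L s, V.P L s, V.P L s, V.n⟩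
/-- The mask gate `mk_s i = b_{L-1-s} ∧ aᵢ`. [folklore] -/
def msk (s i : ℕ) : ℕ := V.base + offM L s + i
/-- The definition line of the mask gate. [folklore] -/
def mkDef (s i : ℕ) : PropForm ℕ := biimp (var (V.msk L s i)) (conj (var (V.b (L - 1 - s))) (var (V.a i)))
/-- The accumulating adder `A_s = D_s ⊕ mk_s`. [folklore] -/
def Av (s : ℕ) : ModAddU.View := ⟨V.base + offA L s, (V.Dv L s).R L, V.msk L s, V.n⟩
/-- The output word `P_L = a ⊗ b`. [folklore] -/
def out (i : ℕ) : ℕ := V.P L L i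

/-- `P_{s+1}` is the output of `A_s`. [folklore] -/
theorem P_succ (s i : ℕ) : V.P L (s + 1) i = (V.Av L s).R L i := by
  simp [P, Av, ModAddU.View.R, Nat.add_assoc]

/-- `P_0` is the zero gate. [folklore] -/
theorem P_zero (i : ℕ) : V.P L 0 i = V.z := rfl

/-- `V.Avail K Γ L`: the zero gate, and for every stage the two modular adders and the mask
row, have their definition lines available. [folklore] -/
structure Avail (K : PropForm ℕ) (Γ : Set (PropForm ℕ)) : Prop where
  /-- the zero gate -/
  hz : ctx K (biimp (var V.z) (const false)) ∈ Γ
  /-- the doubling adders -/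
  hD : ∀ s < L, (V.Dv L s).Avail K Γ L
  /-- the masks -/
  hmk : ∀ s < L, ∀ i < L, ctx K (V.mkDef L s i) ∈ Γ
  /-- the accumulating adders -/
  hA : ∀ s < L, (V.Av L s).Avail K Γ L

/-- Availability is monotone. [folklore] -/
theorem Avail.mono {V : View} {L : ℕ} {K : PropForm ℕ} {Γ Γ' : Set (PropForm ℕ)} (h : V.Avail L K Γ) (hΓ : Γ ⊆ Γ') :
    V.Avail L K Γ' :=
  ⟨hΓ h.hz, fun s hs => (h.hD s hs).mono hΓ, fun s hs i hi => hΓ (h.hmk s hs i hi), fun s hs => (h.hA s hs).mono hΓ⟩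

end View

/-! ### Availability from an occurrence -/

/-- The view of an occurrence of the multiplier. [folklore] -/
def viewOf (o : Occ) (L : ℕ) : View := ⟨o.base, fun i => o.inp i, fun i => o.inp (L + i), fun i => o.inp (2 * L + i)⟩

variable {L} {o : Occ} {K : PropForm ℕ} {Γ : Set (PropForm ℕ)}

/-- Piece `1 + 3s` is the doubling adder. [folklore] -/
theorem pieces_D (s : ℕ) : pieces L (1 + 3 * s) = ⟨ModAddU.modAddT L, 3 * L, wD L s⟩ := by
  rw [show 1 + 3 * s = 3 * s + 0 + 1 by ring, pieces_sr L s 0 (by norm_num)]; rfl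

/-- Piece `2 + 3s` is the mask row. [folklore] -/
theorem pieces_M (s : ℕ) : pieces L (2 + 3 * s) = ⟨maskRow L, L + 1, wM L s⟩ := by
  rw [show 2 + 3 * s = 3 * s + 1 + 1 by ring, pieces_sr L s 1 (by norm_num)]; rfl

/-- Piece `3 + 3s` is the accumulating adder. [folklore] -/
theorem pieces_A (s : ℕ) : pieces L (3 + 3 * s) = ⟨ModAddU.modAddT L, 3 * L, wA L s⟩ := by
  rw [show 3 + 3 * s = 3 * s + 2 + 1 by ring, pieces_sr L s 2 (by norm_num)]; rfl

/-- The offsets of the stage pieces. [folklore] -/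
theorem offset_D (s : ℕ) : offset (pieces L) (1 + 3 * s) = offD L s := by
  rw [offset_pieces, show 1 + 3 * s = 3 * s + 0 + 1 by ring, offF_sr L s 0 (by norm_num)]; rfl

/-- The offsets of the stage pieces. [folklore] -/
theorem offset_M (s : ℕ) : offset (pieces L) (2 + 3 * s) = offM L s := by
  rw [offset_pieces, show 2 + 3 * s = 3 * s + 1 + 1 by ring, offF_sr L s 1 (by norm_num)]; rfl

/-- The offsets of the stage pieces. [folklore] -/
theorem offset_A (s : ℕ) : offset (pieces L) (3 + 3 * s) = offA L s := by
  rw [offset_pieces, show 3 + 3 * s = 3 * s + 2 + 1 by ring, offF_sr L s 2 (by norm_num)]; rfl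

/-- An input of a piece wired to a kit input. [folklore] -/
theorem inp_inl {k i j : ℕ} (hw : (pieces L k).wire i = Sum.inl j) (hj : j < 3 * L) :
    (pieceOcc (o.inst (3 * L)) (pieces L) k).inp i = o.inp j := by
  rw [inp_pieceOcc, hw, Occ.ref_inl o hj]

/-- An input of a piece wired to an earlier gate. [folklore] -/
theorem inp_inr {k i g : ℕ} (hw : (pieces L k).wire i = Sum.inr g) :
    (pieceOcc (o.inst (3 * L)) (pieces L) k).inp i = o.base + g := by
  rw [inp_pieceOcc, hw, Occ.ref_inr]; rfl

/-- The reference to `P_s i` resolves to the view's `P s i`. [folklore] -/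
theorem ref_pRef (s i : ℕ) : (o.inst (3 * L)).ref (pRef L s i) = (viewOf o L).P L s i := by
  unfold pRef View.P
  split_ifs with h
  · rfl
  · rw [Occ.ref_inr]; simp [viewOf, Occ.wire, Nat.add_assoc]

/-- **An available occurrence of the multiplier provides an available view.** [folklore] -/
theorem avail_ofOcc (ho : o.Avail (mulT L) (3 * L) K Γ) : (viewOf o L).Avail L K Γ := by
  refine ⟨?_, fun s hs => ?_, fun s hs i hi => ?_, fun s hs => ?_⟩
  · -- the zero gate: piece 0, gate 0
    have h := Inst.DefsAvail.piece ho (k := 0) (by omega) (by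
      intro j hj; simp only [pieces, if_true, List.length_singleton, Nat.lt_one_iff] at hj
      subst hj; exact ⟨rfl, fun a ha => absurd ha (by simp [pieces])⟩) 0 (by simp [pieces])
    simpa [pieces, Inst.body, Kind.body, Inst.wire, View.z, viewOf, pieceOcc, offset_zero] using h
  · have hq : (pieceOcc (o.inst (3 * L)) (pieces L) (1 + 3 * s)).Avail (ModAddU.modAddT L) (3 * L) K Γ := by
      have := Inst.DefsAvail.piece ho (k := 1 + 3 * s) (by omega) (by rw [pieces_D]; exact ModAddU.wf_modAddT L)
      rw [pieces_D] at this; exact this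
    refine ModAddU.View.Avail.congr (ModAddU.avail_viewOf hq) ?_ (fun i hi => ?_) (fun i hi => ?_) (fun i hi => ?_)
    · show o.base + offD L s = (pieceOcc (o.inst (3 * L)) (pieces L) (1 + 3 * s)).base
      simp [pieceOcc, offset_D]
    · show (viewOf o L).P L s i = ((pieceOcc (o.inst (3 * L)) (pieces L) (1 + 3 * s)).inst (3 * L)).inputs.getD i 0
      rw [Occ.getD_inst _ (show i < 3 * L by omega), inp_pieceOcc, pieces_D]
      show _ = (o.inst (3 * L)).ref (wD L s i)
      rw [wD, if_pos hi, ref_pRef]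
    · show (viewOf o L).P L s i = ((pieceOcc (o.inst (3 * L)) (pieces L) (1 + 3 * s)).inst (3 * L)).inputs.getD (L + i) 0
      rw [Occ.getD_inst _ (show L + i < 3 * L by omega), inp_pieceOcc, pieces_D]
      show _ = (o.inst (3 * L)).ref (wD L s (L + i))
      rw [wD, if_neg (by omega), if_pos (by omega), Nat.add_sub_cancel_left, ref_pRef]
    · show o.inp (2 * L + i) = ((pieceOcc (o.inst (3 * L)) (pieces L) (1 + 3 * s)).inst (3 * L)).inputs.getD (2 * L + i) 0
      rw [Occ.getD_inst _ (show 2 * L + i < 3 * L by omega), inp_pieceOcc, pieces_D]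
      show _ = (o.inst (3 * L)).ref (wD L s (2 * L + i))
      rw [wD, if_neg (by omega), if_neg (by omega), Occ.ref_inl _ (by omega)]
  · have hq : (pieceOcc (o.inst (3 * L)) (pieces L) (2 + 3 * s)).Avail (maskRow L) (L + 1) K Γ := by
      have := Inst.DefsAvail.piece ho (k := 2 + 3 * s) (by omega) (by rw [pieces_M]; exact wf_maskRow L)
      rw [pieces_M] at this; exact this
    have h := hq i (by simpa using hi)
    rw [getElem_maskRow] at h
    have e0 : (o.inst (3 * L)).ref ((pieces L (2 + 3 * s)).wire 0) = o.inp (L + (L - 1 - s)) := by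
      rw [pieces_M]; show (o.inst (3 * L)).ref (wM L s 0) = _
      rw [wM, if_pos rfl, Occ.ref_inl _ (by omega)]
    have e1 : (o.inst (3 * L)).ref ((pieces L (2 + 3 * s)).wire (1 + i)) = o.inp i := by
      rw [pieces_M]; show (o.inst (3 * L)).ref (wM L s (1 + i)) = _
      rw [wM, if_neg (by omega), Nat.add_sub_cancel_left, Occ.ref_inl _ (by omega)]
    have ew : ((pieceOcc (o.inst (3 * L)) (pieces L) (2 + 3 * s)).inst (L + 1)).wire i = (viewOf o L).msk L s i := by
      simp [pieceOcc, offset_M, View.msk, viewOf, Inst.wire, Occ.inst, Nat.add_assoc]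
    simpa [Inst.body, Kind.body, arg, View.mkDef, viewOf, ew,
      Occ.ref_inl (pieceOcc (o.inst (3 * L)) (pieces L) (2 + 3 * s)) (show 0 < L + 1 by omega),
      Occ.ref_inl (pieceOcc (o.inst (3 * L)) (pieces L) (2 + 3 * s)) (show 1 + i < L + 1 by omega), e0, e1] using h
  · have hq : (pieceOcc (o.inst (3 * L)) (pieces L) (3 + 3 * s)).Avail (ModAddU.modAddT L) (3 * L) K Γ := by
      have := Inst.DefsAvail.piece ho (k := 3 + 3 * s) (by omega) (by rw [pieces_A]; exact ModAddU.wf_modAddT L)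
      rw [pieces_A] at this; exact this
    refine ModAddU.View.Avail.congr (ModAddU.avail_viewOf hq) ?_ (fun i hi => ?_) (fun i hi => ?_) (fun i hi => ?_)
    · show o.base + offA L s = (pieceOcc (o.inst (3 * L)) (pieces L) (3 + 3 * s)).base
      simp [pieceOcc, offset_A]
    · show ((viewOf o L).Dv L s).R L i = ((pieceOcc (o.inst (3 * L)) (pieces L) (3 + 3 * s)).inst (3 * L)).inputs.getD i 0
      rw [Occ.getD_inst _ (show i < 3 * L by omega), inp_pieceOcc, pieces_A]
      show _ = (o.inst (3 * L)).ref (wA L s i)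
      rw [wA, if_pos hi, Occ.ref_inr]
      simp [View.Dv, ModAddU.View.R, viewOf, Occ.wire, Nat.add_assoc]
    · show (viewOf o L).msk L s i = ((pieceOcc (o.inst (3 * L)) (pieces L) (3 + 3 * s)).inst (3 * L)).inputs.getD (L + i) 0
      rw [Occ.getD_inst _ (show L + i < 3 * L by omega), inp_pieceOcc, pieces_A]
      show _ = (o.inst (3 * L)).ref (wA L s (L + i))
      rw [wA, if_neg (by omega), if_pos (by omega), Nat.add_sub_cancel_left, Occ.ref_inr]
      simp [View.msk, viewOf, Occ.wire, Nat.add_assoc]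
    · show o.inp (2 * L + i) = ((pieceOcc (o.inst (3 * L)) (pieces L) (3 + 3 * s)).inst (3 * L)).inputs.getD (2 * L + i) 0
      rw [Occ.getD_inst _ (show 2 * L + i < 3 * L by omega), inp_pieceOcc, pieces_A]
      show _ = (o.inst (3 * L)).ref (wA L s (2 * L + i))
      rw [wA, if_neg (by omega), if_neg (by omega), Occ.ref_inl _ (by omega)]

end ModMulU

end Literature.Computability.MetaComplexity
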